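import Literature.AnabelianGeometry.SemiGraphs.TemperedResiduallyFiniteHolds
import Literature.AnabelianGeometry.SemiGraphs.TemperedResiduallyFinitePointed
import HarnessLib

/-!
# [SemiAnbd] Prop. 3.6 (iii), proof p. 39: Galois domination in `B^temp(𝒢)` — unconditional

Mochizuki, *Semi-graphs of anabelioids*, Publ. RIMS **42** (2006), proof of Prop. 3.6, p. 39: "every
connected tempered covering `H → G` appears as a subcovering of some `G_{∞,i} → G`", the Galois
tempered coverings `G_{∞,i} → G` having "Galois groups" `Gal(G_{∞,i}/G)` — extensions of the finite
`Gal(G_i/G)` by the free `Gal(G_{∞,i}/G_i)` — which are residually finite ("discrete free groups …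
are always residually finite [cf., e.g., Corollary 1.7]", p. 40) [cite: MochizukiSemiAnbd2006, Prop 3.6(iii) pp.38–40].

PROOF-ONLY packaging (abc-iut L3; inputs by name from the G10 rung-2 chain of abc-iut-L3-d5 /
abc-iut-w4-d064 / abc-iut-L3-t9): `galoisDomination_pointed_of_galoisApproxPt`
(`TemperedResiduallyFiniteAssembly.lean`) fed with the now-proved `galoisApproxPt_of_prop36` and
`univCoverOverHomogeneous_holds` (`TemperedResiduallyFiniteHolds.lean`), and a point of a connected
object (`nonempty_point_of_isConnectedObj`, `TemperedCoveringsComponents.lean`):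

* `galoisDomination_pointed_of_prop36` — every POINTED object of `B^temp(𝒢)` receives an arrow from a
  Galois object with residually finite automorphism group;
* `galoisDomination_of_prop36` — the same for every categorically CONNECTED object: VERBATIM the
  hypothesis `hGal` of the [IUTchI] §2 chain (`TemperedGraphGroupData.prop21_of_chart_of_isProfiniteCompletion`,
  `…NodNon…`, `…At…`), now a theorem BY NAME under `Prop36Hypotheses`.

No definitions; nothing here takes a side on [IUTchIII] Cor. 3.12.
-/

namespace Literature.AnabelianGeometry.SemiGraphs

open CategoryTheory CategoryTheory.Limits
open Literature.AlgebraicGeometry.Frobenioids (IsConnectedObj)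

universe u

namespace ProfiniteSemiGraph

variable {𝒢 : ProfiniteSemiGraph.{u}}

/-- **Pointed Galois domination, unconditional under `Prop36Hypotheses`** ([SemiAnbd] proof of
Prop. 3.6, p. 39): every object `S` of `B^temp(𝒢)` with a point receives an arrow from a Galois object
`H = 𝒢_{∞,A}` of `B^temp(𝒢)` whose automorphism group is residually finite.
[cite: MochizukiSemiAnbd2006, Prop 3.6(iii) pp.38–39] -/
theorem galoisDomination_pointed_of_prop36 (h36 : 𝒢.Prop36Hypotheses) (S : BTempCat 𝒢)
    (p : S.obj.Point) :
    ∃ (H : BTempCat 𝒢) (_ : H ⟶ S), IsGaloisObj H ∧ Group.ResiduallyFinite (Aut H) :=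
  galoisDomination_pointed_of_galoisApproxPt 𝒢 h36 (𝒢.galoisApproxPt_of_prop36 h36)
    𝒢.univCoverOverHomogeneous_holds S p

/-- **Galois domination of connected tempered coverings, unconditional under `Prop36Hypotheses`**
([SemiAnbd] proof of Prop. 3.6, p. 39: "every connected tempered covering `H → G` appears as a
subcovering of some `G_{∞,i} → G`", with `Gal(G_{∞,i}/G)` residually finite): every categorically
connected object `S` of `B^temp(𝒢)` receives an arrow from a Galois object with residually finite
automorphism group — the hypothesis `hGal` of the [IUTchI] §2 chain, verbatim.
[cite: MochizukiSemiAnbd2006, Prop 3.6(iii) pp.38–39] -/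
theorem galoisDomination_of_prop36 (h36 : 𝒢.Prop36Hypotheses) :
    ∀ S : BTempCat 𝒢, IsConnectedObj S →
      ∃ (H : BTempCat 𝒢) (_ : H ⟶ S), IsGaloisObj H ∧ Group.ResiduallyFinite (Aut H) :=
  fun S hS => (nonempty_point_of_isConnectedObj S hS).elim
    fun p => galoisDomination_pointed_of_prop36 h36 S p

end ProfiniteSemiGraph

end Literature.AnabelianGeometry.SemiGraphs
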